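import Summits.QuantumFields.BalabanUV.T4Continuum.Spine.NE1p.DressedSmallFieldPencil

/-!
# T⁴ programme, spine estimate NE1′ (node O3b/H2) — THE DRESSED OUTPUT IS HOLOMORPHIC IN ANY PARAMETER IN WHICH THE ACTIVITIES
# ARE (under a parameter-free (2.38)-majorant): B13 p. 15's analyticity sentence as a kernel implication over an arbitrary
# complex normed parameter space, and the analyticity half of the births binder (w1) for REGENERATED observable-attached
# generations — jointly in (source, background) — from per-polymer data

Cell `pub-balaban`, sub-cell `t4`, BINDER-OWNERS row NE1′; owner lineage t4-ne1p-p1 (PROVER seat P1, «RG-trajectory comparison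
…»), generation 26; ADDITIVE — imports N0j `Spine/NE1p/DressedSmallFieldPencil` (p220020) ONLY; THEOREMS ONLY (+ one `example`).

WHY THIS FILE.  The wall's births binder (w1) asks, for every observable-attached generation, analyticity of the born term on
print's complex background space (the (1.18)-TYPE datum: [Balaban1987RGI] p. 263 «defined and analytic on the space U^c_j(X, α₀,
α₁)» with a uniform bound).  For the generations RE-BORN at a small-field step (the attached part of that step's output, (w5)),
print's own mechanism is the sentence [Balaban1988RGII] p. 15 «Thus the activities in (2.13), and the whole sum E^{(k+1)}(X),
are analytic functions of (𝐔, 𝐉), on the space 𝐔^c_{k+1}(X, α₀, α₁). This is the analyticity statement in the inductive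
assumptions.» (LOCUS, TYPE; reproduced with its [cite] tag in `T4ActivityLipschitz`'s header) — an implication «activities
analytic + convergence ⇒ output analytic» which print does not spell out.  N0j §2 proved it in kernel for the SOURCE parameter
(`P = ℂ`); the proof never used that the parameter is one complex number: the tree's `differentiableOn_polymerLogZ_param` is
stated for a parameter in ANY complex normed space.  THIS FILE records the general form:
* §1 `differentiableOn_locE_param` — activities complex (Fréchet) differentiable in `p ∈ U` (open subset of a complex normed
  space `P`) polymer by polymer, dominated on `U` by a parameter-free majorant of the (2.38)-shape, + B13's footprint-locality ∕
  (1.26) ∕ volume binders + the one-run clauses ⇒ `p ↦ locE (act p) X` complex differentiable on `U` ([KP86] zero-freeness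
  uniformly on `U` via B13's `kp_condition`; `differentiableOn_polymerLogZ_param`; finite sums);
  `analytic_and_bounded_locE_param` — together with `B13Resummation.norm_locE_le_of_small` the PAIR «analytic on `U` + bounded
  by the (2.41) envelope there» = the (1.18)-TYPE datum of a new term, from per-polymer data.
* §2 the source disc (N0j §2) as the case `P = ℂ` (an `example`, by name), and `differentiableOn_locE_source_background`: JOINT
  holomorphy on `ball 0 μ₁ ×ˢ W` for `P = ℂ × B` (`B` the background space, `W` open — the TYPE of `𝐔^c_{k+1}(X, α₀, α₁)`): the
  re-born attached term is analytic in (μ, 𝐔, 𝐉) jointly — the analyticity half of (w1) for regenerated generations. WHAT THIS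
  LOCALISES.  (w1) for REGENERATED generations ⇐ [kernel, this file] per-polymer analyticity of the dressed activities in (μ,
  background) on the product domain with a parameter-free (2.38)-majorant ((E1)∕(E2) in the joint parameter — by N0k's
  `differentiableOn_term_comp` ∕ `Literature.Analysis.Complex.differentiableOn_integral_of_dominated` this is, for the
  (2.14)-shape, analyticity of the PREFACTOR and of the functionals in the background — print's p. 15 «The quadratic forms and
  covariances in H(Z) are analytic functions on the space of configurations (𝐔, 𝐉) satisfying the conditions I.(i)–(iii) on the
  domain Z» (TYPE, for Bałaban's data) — and of the dressed table in (μ, background) = (w1) for the CARRIED generations through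
  Lemma 1's linear map) ∧ (B3) `hL3` ∧ (B4) geometry ∧ (B5) clauses.  So the NEW-UNPRINTED content of (w1) is concentrated in
  the generations born AT THE OBSERVABLE'S OWN SCALE (the first dressed step) and in the background-analyticity of print's
  μ-free data (printed TYPE); the regeneration adds no new analyticity estimate.  The G^c-gauge-invariance and chart-membership
  parts of (w1) are NOT addressed here.

HONEST FRAMING.  [folklore] kernel over SHAPES (by-name composition of the tree's [KP86] theorems with B13's `kp_condition`);
nothing of Bałaban's densities instantiated; loci are TYPE∕CONTEXT; ABSOLUTE RULE honoured.  NE1′ NOT printed, NOT proved; spine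
PROVED 0∕9; count 9 unchanged.  Rung (B)+1 on ONE finite four-torus — NOT infinite volume, NOT a mass gap, NOT OS on ℝ⁴, NOT
Clay.  HONEST DEPENDENCY: continuum YM on T⁴ ⇐ BetaPertH ∧ nine spine estimates (0/9 proved); BetaPertH ⇐ (D1) ∧ (D4) ∧
CAP+tail; G-an2-4 gates asym, D1 and NE2/3/4.
-/

noncomputable section

namespace Summit.QuantumFields.BalabanUV.T4Continuum.NE1p.DressedOutputAnalytic

open Metric Set Complex
open scoped BigOperators
open Literature.Probability.LatticeModels (truncatedWeight polymerLogZ polymerPartitionFunction IsKPVolume kpTerm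
  isKPVolume_of_kpd polymerPartitionFunction_ne_zero_of_kp differentiableOn_polymerLogZ_param)
open Literature.MathematicalPhysics.QuantumFieldTheory.Balaban1983to89.B13FamilySum (Ineq126 VolBound Ineq227)
open Literature.MathematicalPhysics.QuantumFieldTheory.Balaban1983to89.B13Resummation (locE kp_condition locE_congr
  norm_locE_le_of_small)

variable {P : Type*} [NormedAddCommGroup P] [NormedSpace ℂ P]
variable {Dom Cube : Type*} [DecidableEq Dom] [DecidableEq Cube] [Fintype Dom]
variable (ι : Dom → Dom → Prop) [DecidableRel ι]

/-! ## §1 THE OUTPUT IS HOLOMORPHIC IN ANY PARAMETER IN WHICH THE ACTIVITIES ARE, under a parameter-free (2.38)-majorant -/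

/-- **B13 p. 15's sentence as a kernel implication, for ANY complex parameter space** («Thus the activities in (2.13), and the
whole sum E^{(k+1)}(X), are analytic functions of (𝐔,𝐉), on the space 𝐔^c_{k+1}(X,α₀,α₁)» — LOCUS, TYPE): if the activities `act
p Z` are complex (Fréchet) differentiable in a parameter `p` ranging over an OPEN set `U` of a complex normed space `P`, polymer
by polymer (`hhol`), and dominated there by a PARAMETER-FREE majorant of the (2.38)-shape (`hm`, `hL3`), then under B13's
footprint-locality ∕ (1.26) ∕ volume binders and the one-run clauses of `B13Resummation.norm_locE_le_of_small` the localized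
output `p ↦ E_p(X) = locE (act p) X` is complex differentiable on `U`.  Proof =
`DressedSmallFieldPencil.differentiableOn_locE_of_majorant`'s with the source disc replaced by `U`: `kp_condition` uniformly in
`p` ⇒ [KP86] zero-freeness of every ray of every sub-volume partition function (`polymerPartitionFunction_ne_zero_of_kp`) ⇒
`differentiableOn_polymerLogZ_param` (stated in the tree for a general normed parameter space) ⇒ truncated functionals ⇒ `locE`.
[folklore] -/
theorem differentiableOn_locE_param [Std.Refl ι] [Std.Symm ι] {cubes reach : Dom → Finset Cube} {d : Dom → ℝ}
    {m : Dom → ℝ} {act : P → Dom → ℂ} {A R r₁ κ₀ K₀ c₁ c b ν : ℝ} {X : Finset Cube} {U : Set P} (hU : IsOpen U)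
    (hloc : ∀ Z Z', ι Z' Z → ∃ q ∈ reach Z, q ∈ cubes Z')
    (hreach : ∀ Z, ((reach Z).card : ℝ) ≤ ν * (cubes Z).card)
    (hd : ∀ Z, 0 ≤ d Z) (hA : 0 ≤ A) (hK₀ : 0 ≤ K₀) (hν : 0 ≤ ν) (hκ₀ : 0 ≤ κ₀)
    (hr₁ : 0 ≤ r₁) (hc : 0 ≤ c) (hb : r₁ * c ≤ b)
    (h126 : Ineq126 (Finset.univ : Finset Dom) cubes d κ₀ K₀)
    (hvol : VolBound (Finset.univ : Finset Dom) cubes d c₁)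
    (hrate : r₁ + 2 * κ₀ + 2 ≤ R) (hsmall : A * Real.exp (b + 1) * K₀ * ν * c₁ ≤ 1)
    (hhol : ∀ Z, cubes Z ⊆ X → DifferentiableOn ℂ (fun p => act p Z) U)
    (hm : ∀ p ∈ U, ∀ Z, cubes Z ⊆ X → ‖act p Z‖ ≤ m Z)
    (hL3 : ∀ Z, cubes Z ⊆ X → m Z ≤ A * Real.exp (-(R * d Z))) :
    DifferentiableOn ℂ (fun p => locE ι cubes (act p) X) U := by
  -- truncate the activities to the polymers inside `X`
  set w' : P → Dom → ℂ := fun p Z => if cubes Z ⊆ X then act p Z else 0 with hw'_def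
  have hcongr : ∀ p, locE ι cubes (act p) X = locE ι cubes (w' p) X := fun p =>
    locE_congr ι fun Z hZ => by simp only [hw'_def, hZ, if_true]
  have hhol' : ∀ Z, DifferentiableOn ℂ (fun p => w' p Z) U := by
    intro Z
    by_cases h : cubes Z ⊆ X
    · simp only [hw'_def, h, if_true]; exact hhol Z h
    · simp only [hw'_def, h, if_false]; exact differentiableOn_const 0
  have hw'A : ∀ p ∈ U, ∀ Z, ‖w' p Z‖ ≤ A * Real.exp (-(R * d Z)) := by
    intro p hp Z
    by_cases h : cubes Z ⊆ X
    · simp only [hw'_def, h, if_true]; exact (hm p hp Z h).trans (hL3 Z h)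
    · simp only [hw'_def, h, if_false, norm_zero]; exact mul_nonneg hA (Real.exp_nonneg _)
  -- [KP86] (1) for `w' p`, uniformly on `U`
  set τ : ℝ := A * Real.exp (b + 1) * K₀ * ν with hτ_def
  have hτ : 0 ≤ τ := by positivity
  have hb0 : 0 ≤ b := le_trans (mul_nonneg hr₁ hc) hb
  have hsmall' : A * Real.exp (b + τ * c₁) * K₀ * ν ≤ τ := by
    have hexp : Real.exp (b + τ * c₁) ≤ Real.exp (b + 1) := Real.exp_le_exp.2 (by linarith)
    calc A * Real.exp (b + τ * c₁) * K₀ * ν ≤ A * Real.exp (b + 1) * K₀ * ν := by gcongr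
      _ = τ := rfl
  have hKP : ∀ p ∈ U, ∀ Z ∈ (Finset.univ : Finset Dom),
      ∑ Z' ∈ Finset.univ with ι Z' Z,
        ‖w' p Z'‖ * Real.exp (τ * ((cubes Z').card : ℝ) + ((r₁ + (κ₀ + 1)) * d Z' + b)) ≤
          τ * ((cubes Z).card : ℝ) := fun p hp Z _ =>
    kp_condition ι hloc hreach hd hA hK₀ hτ (hw'A p hp) h126 hvol (s := r₁ + (κ₀ + 1)) (b := b) (by linarith)
      hsmall' Z
  -- zero-freeness of every ray of every sub-volume partition function on `U`
  have hdK : ∀ Z, 0 ≤ (r₁ + (κ₀ + 1)) * d Z + b := fun Z => add_nonneg (mul_nonneg (by linarith) (hd Z)) hb0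
  have hZ : ∀ p ∈ U, ∀ B : Finset Dom, ∀ t ∈ Set.Icc (0 : ℝ) 1,
      polymerPartitionFunction ι (fun Z => (t : ℂ) * w' p Z) B ≠ 0 := by
    intro p hp B t ht
    have hKPs : IsKPVolume ι (w' p) (fun Z => τ * ((cubes Z).card : ℝ)) Finset.univ :=
      isKPVolume_of_kpd (a := fun Z => τ * ((cubes Z).card : ℝ)) (d := fun Z => (r₁ + (κ₀ + 1)) * d Z + b) hdK
        (hKP p hp)
    have hKPt : IsKPVolume ι (fun Z => (t : ℂ) * w' p Z) (fun Z => τ * ((cubes Z).card : ℝ)) Finset.univ := by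
      intro Z₀ hZ₀
      refine le_trans (Finset.sum_le_sum fun Z' _ => ?_) (hKPs Z₀ hZ₀)
      unfold kpTerm
      refine mul_le_mul_of_nonneg_right ?_ (Real.exp_nonneg _)
      rw [norm_mul, Complex.norm_real, Real.norm_eq_abs, abs_of_nonneg ht.1]
      exact mul_le_of_le_one_left (norm_nonneg _) ht.2
    exact polymerPartitionFunction_ne_zero_of_kp hKPt (Finset.subset_univ B)
  -- holomorphy of every `log Z(B; w' p)`, of every truncated functional, of `locE`
  have hlog : ∀ B : Finset Dom, DifferentiableOn ℂ (fun p => polymerLogZ ι (w' p) B) U := fun B =>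
    differentiableOn_polymerLogZ_param (v := w') B hU (fun Z _ => hhol' Z) fun p hp t ht => hZ p hp B t ht
  have htw : ∀ C : Finset Dom, DifferentiableOn ℂ (fun p => truncatedWeight ι (w' p) C) U := by
    intro C
    unfold truncatedWeight
    exact DifferentiableOn.fun_sum fun B _ => (differentiableOn_const _).mul (hlog B)
  have hE : DifferentiableOn ℂ (fun p => locE ι cubes (w' p) X) U := by
    unfold locE
    exact DifferentiableOn.fun_sum fun C _ => htw C
  exact hE.congr fun p _ => hcongr p

/-- **… AND BOUNDED BY THE (2.41) ENVELOPE UNIFORMLY ON `U`** (`B13Resummation.norm_locE_le_of_small` BY NAME at every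
parameter): the pair «analytic on `U` + bounded by `e ν c₁ K₀² A e^{−r₁ d(X)}` there» — the (1.18)-TYPE datum of a NEW term born
at this step (analyticity domain `U` = print's `𝐔^c_{k+1}(X, α₀, α₁)` × the source disc, in the dressed run), from per-polymer
data. [folklore] -/
theorem analytic_and_bounded_locE_param [Std.Refl ι] [Std.Symm ι] {cubes reach : Dom → Finset Cube} {d : Dom → ℝ}
    {m : Dom → ℝ} {act : P → Dom → ℂ} {A R r₁ κ₀ K₀ c₁ c b ν dX : ℝ} {X : Finset Cube} {U : Set P} (hU : IsOpen U)
    (hloc : ∀ Z Z', ι Z' Z → ∃ q ∈ reach Z, q ∈ cubes Z')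
    (hreach : ∀ Z, ((reach Z).card : ℝ) ≤ ν * (cubes Z).card)
    (hd : ∀ Z, 0 ≤ d Z) (hA : 0 ≤ A) (hK₀ : 0 ≤ K₀) (hc₁ : 0 ≤ c₁) (hν : 0 ≤ ν) (hκ₀ : 0 ≤ κ₀)
    (hr₁ : 0 ≤ r₁) (hc : 0 ≤ c) (hb : r₁ * c ≤ b)
    (h126 : Ineq126 (Finset.univ : Finset Dom) cubes d κ₀ K₀)
    (hvol : VolBound (Finset.univ : Finset Dom) cubes d c₁)
    (h227 : Ineq227 (Finset.univ : Finset Dom) cubes d X dX c)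
    (hrate : r₁ + 2 * κ₀ + 2 ≤ R) (hsmall : A * Real.exp (b + 1) * K₀ * ν * c₁ ≤ 1) (hX : X.Nonempty)
    (hhol : ∀ Z, cubes Z ⊆ X → DifferentiableOn ℂ (fun p => act p Z) U)
    (hm : ∀ p ∈ U, ∀ Z, cubes Z ⊆ X → ‖act p Z‖ ≤ m Z)
    (hL3 : ∀ Z, cubes Z ⊆ X → m Z ≤ A * Real.exp (-(R * d Z))) :
    DifferentiableOn ℂ (fun p => locE ι cubes (act p) X) U ∧
      ∀ p ∈ U, ‖locE ι cubes (act p) X‖ ≤ Real.exp 1 * ν * c₁ * K₀ ^ 2 * A * Real.exp (-(r₁ * dX)) :=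
  ⟨differentiableOn_locE_param ι hU hloc hreach hd hA hK₀ hν hκ₀ hr₁ hc hb h126 hvol hrate hsmall hhol hm hL3,
    fun p hp => norm_locE_le_of_small ι hloc hreach hd hA hK₀ hc₁ hν hκ₀ hr₁ hc hb
      (fun Z hZ => (hm p hp Z hZ).trans (hL3 Z hZ)) h126 hvol h227 hrate hsmall hX⟩

/-! ## §2 The source disc as a special case, and JOINT holomorphy in (source, background) -/

/-- `DressedSmallFieldPencil.differentiableOn_locE_of_majorant` (source disc) is the case `P = ℂ`, `U = ball 0 μ₁` — recovered
BY NAME from §1 (consistency). [folklore] -/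
example [Std.Refl ι] [Std.Symm ι] {cubes reach : Dom → Finset Cube} {d : Dom → ℝ}
    {m : Dom → ℝ} {act : ℂ → Dom → ℂ} {A R r₁ κ₀ K₀ c₁ c b ν μ₁ : ℝ} {X : Finset Cube}
    (hloc : ∀ Z Z', ι Z' Z → ∃ q ∈ reach Z, q ∈ cubes Z')
    (hreach : ∀ Z, ((reach Z).card : ℝ) ≤ ν * (cubes Z).card)
    (hd : ∀ Z, 0 ≤ d Z) (hA : 0 ≤ A) (hK₀ : 0 ≤ K₀) (hν : 0 ≤ ν) (hκ₀ : 0 ≤ κ₀)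
    (hr₁ : 0 ≤ r₁) (hc : 0 ≤ c) (hb : r₁ * c ≤ b)
    (h126 : Ineq126 (Finset.univ : Finset Dom) cubes d κ₀ K₀)
    (hvol : VolBound (Finset.univ : Finset Dom) cubes d c₁)
    (hrate : r₁ + 2 * κ₀ + 2 ≤ R) (hsmall : A * Real.exp (b + 1) * K₀ * ν * c₁ ≤ 1)
    (hhol : ∀ Z, cubes Z ⊆ X → DifferentiableOn ℂ (fun s => act s Z) (ball (0 : ℂ) μ₁))
    (hm : ∀ s ∈ ball (0 : ℂ) μ₁, ∀ Z, cubes Z ⊆ X → ‖act s Z‖ ≤ m Z)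
    (hL3 : ∀ Z, cubes Z ⊆ X → m Z ≤ A * Real.exp (-(R * d Z))) :
    DifferentiableOn ℂ (fun s => locE ι cubes (act s) X) (ball (0 : ℂ) μ₁) :=
  differentiableOn_locE_param ι isOpen_ball hloc hreach hd hA hK₀ hν hκ₀ hr₁ hc hb h126 hvol hrate hsmall hhol hm hL3

/-- **JOINT HOLOMORPHY IN (SOURCE, BACKGROUND)** [folklore]: with the parameter space `ℂ × B` (`B` a complex normed space of
background data — the TYPE of print's `(𝐔,𝐉)`-space restricted to a domain) and the open set `ball 0 μ₁ ×ˢ W` (`W` open — the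
TYPE of `𝐔^c_{k+1}(X, α₀, α₁)`), §1 gives the dressed output JOINTLY complex differentiable in (μ, background): the new
observable- attached term born at this step is an analytic function of the source AND of the background on the product domain —
the analyticity half of the births binder (w1) for REGENERATED generations, from per-polymer data + print-TYPE binders. -/
theorem differentiableOn_locE_source_background [Std.Refl ι] [Std.Symm ι] {B : Type*} [NormedAddCommGroup B]
    [NormedSpace ℂ B] {cubes reach : Dom → Finset Cube} {d : Dom → ℝ}
    {m : Dom → ℝ} {act : ℂ × B → Dom → ℂ} {A R r₁ κ₀ K₀ c₁ c b ν μ₁ : ℝ} {X : Finset Cube} {W : Set B} (hW : IsOpen W)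
    (hloc : ∀ Z Z', ι Z' Z → ∃ q ∈ reach Z, q ∈ cubes Z')
    (hreach : ∀ Z, ((reach Z).card : ℝ) ≤ ν * (cubes Z).card)
    (hd : ∀ Z, 0 ≤ d Z) (hA : 0 ≤ A) (hK₀ : 0 ≤ K₀) (hν : 0 ≤ ν) (hκ₀ : 0 ≤ κ₀)
    (hr₁ : 0 ≤ r₁) (hc : 0 ≤ c) (hb : r₁ * c ≤ b)
    (h126 : Ineq126 (Finset.univ : Finset Dom) cubes d κ₀ K₀)
    (hvol : VolBound (Finset.univ : Finset Dom) cubes d c₁)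
    (hrate : r₁ + 2 * κ₀ + 2 ≤ R) (hsmall : A * Real.exp (b + 1) * K₀ * ν * c₁ ≤ 1)
    (hhol : ∀ Z, cubes Z ⊆ X → DifferentiableOn ℂ (fun p => act p Z) (ball (0 : ℂ) μ₁ ×ˢ W))
    (hm : ∀ p ∈ ball (0 : ℂ) μ₁ ×ˢ W, ∀ Z, cubes Z ⊆ X → ‖act p Z‖ ≤ m Z)
    (hL3 : ∀ Z, cubes Z ⊆ X → m Z ≤ A * Real.exp (-(R * d Z))) :
    DifferentiableOn ℂ (fun p => locE ι cubes (act p) X) (ball (0 : ℂ) μ₁ ×ˢ W) :=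
  differentiableOn_locE_param ι (isOpen_ball.prod hW) hloc hreach hd hA hK₀ hν hκ₀ hr₁ hc hb h126 hvol hrate hsmall
    hhol hm hL3

end Summit.QuantumFields.BalabanUV.T4Continuum.NE1p.DressedOutputAnalytic

end
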